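import Mathlib.LinearAlgebra.Dimension.Constructions
import Mathlib.LinearAlgebra.Dimension.Finrank
import Mathlib.LinearAlgebra.FiniteDimensional.Defs
import Mathlib.Order.Monotone.Basic
import Mathlib.Tactic.Linarith
import HarnessLib

/-!
# Venture HSemireg — rank monotonicity under intertwining, and the squeeze that closes a table

Elementary bookkeeping behind THEOREM U2∞ of the computation cell `pub-hsemireg` (seat w1-tw-2,
`widen/W1/U2INF-tw2.md` §1 steps (5) and (7)): the first-order deformation module of an explicit
union of five planes is cut out, degree by degree, of free modules of dimension `15k + 38` by a
family of linear conditions `Γ_k` (and its trivial part by conditions `D_k`); multiplication by a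
linear form that does not vanish on the four double lines maps degree `k` to degree `k + 1` and
INTERTWINES `Γ_k` with `Γ_{k+1}` up to an injective (diagonal) map — so the ranks can only grow
with `k` — while four explicit classes keep the quotient of dimension at least `4`; since
`dim T¹_k = 28 − rank Γ_k − rank D_k` and both ranks are already `12` at `k = 1`, the table
`dim T¹_k = 4` is forced for every `k ≥ 1` without any regularity or Gröbner bound.

* `finrank_range_le_of_intertwine` — if `Γ₂ ∘ m = Λ ∘ Γ₁` with `Λ` injective (finite-dimensional
  target), then `finrank (range Γ₁) ≤ finrank (range Γ₂)`;
* `squeeze_const` — if `T k = C − r k − d k` with `r`, `d` monotone, `B ≤ T k` for all `k`, and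
  `T k₀ = B`, then `T k = B` for every `k ≥ k₀` (and `r`, `d` are then constant from `k₀` on:
  `squeeze_ranks_const`).

HONEST FRAMING. Linear algebra over a field and integer bookkeeping only; the Lean index of two
steps of a hand proof about ONE explicit germ's T¹. No sheaf, complex, abelian variety or
semiregularity map appears; nothing here says that HC, HC_CM or HC_AV holds, and nothing here is
a new case of anything.
-/

namespace Summit.Ventures.HSemireg

namespace RankSqueeze

open Module

section Intertwine

variable {K : Type*} [Field K]
variable {V₁ V₂ W₁ W₂ : Type*} [AddCommGroup V₁] [Module K V₁] [AddCommGroup V₂] [Module K V₂]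
  [AddCommGroup W₁] [Module K W₁] [AddCommGroup W₂] [Module K W₂]

/-- **Rank monotonicity under intertwining.** If `Γ₂ ∘ m = Λ ∘ Γ₁` with `Λ` injective and the
target of `Γ₂` finite-dimensional, then `rank Γ₁ ≤ rank Γ₂` (as `finrank` of the ranges): the
image of `Γ₁` is carried injectively by `Λ` into the image of `Γ₂ ∘ m ⊆` the image of `Γ₂`. In the
note: `m` = multiplication by a linear form non-zero on the axes, `Λ` = the induced diagonal
scaling of the «top coefficient» functionals. -/
theorem finrank_range_le_of_intertwine [FiniteDimensional K W₂]
    (Γ₁ : V₁ →ₗ[K] W₁) (Γ₂ : V₂ →ₗ[K] W₂) (m : V₁ →ₗ[K] V₂) (Λ : W₁ →ₗ[K] W₂)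
    (hΛ : Function.Injective Λ) (h : Γ₂ ∘ₗ m = Λ ∘ₗ Γ₁) :
    finrank K (LinearMap.range Γ₁) ≤ finrank K (LinearMap.range Γ₂) := by
  have e : LinearMap.range Γ₁ ≃ₗ[K] (LinearMap.range Γ₁).map Λ :=
    Submodule.equivMapOfInjective Λ hΛ _
  have h1 : finrank K (LinearMap.range Γ₁) = finrank K ((LinearMap.range Γ₁).map Λ) :=
    LinearEquiv.finrank_eq e
  have h2 : (LinearMap.range Γ₁).map Λ = LinearMap.range (Γ₂ ∘ₗ m) := by
    rw [h, LinearMap.range_comp]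
  have h3 : LinearMap.range (Γ₂ ∘ₗ m) ≤ LinearMap.range Γ₂ := LinearMap.range_comp_le_range m Γ₂
  rw [h1, h2]
  exact Submodule.finrank_mono h3

end Intertwine

section Squeeze

/-- **The squeeze.** `T k = C - r k - d k` with `r`, `d` monotone, a uniform lower bound
`B ≤ T k`, and `T k₀ = B` force `T k = B` for all `k ≥ k₀`. (In the note: `C = 28`, `B = 4`,
`r = rank Γ`, `d = rank D`, `k₀ = 1`.) -/
theorem squeeze_const (T r d : ℕ → ℤ) (C B : ℤ) (k₀ : ℕ)
    (hT : ∀ k, k₀ ≤ k → T k = C - r k - d k) (hr : Monotone r) (hd : Monotone d)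
    (hB : ∀ k, k₀ ≤ k → B ≤ T k) (h0 : T k₀ = B) :
    ∀ k, k₀ ≤ k → T k = B := by
  intro k hk
  have hrk := hr hk
  have hdk := hd hk
  have hTk := hT k hk
  have hT0 := hT k₀ le_rfl
  have hBk := hB k hk
  have : T k ≤ T k₀ := by rw [hTk, hT0]; linarith
  rw [h0] at this
  exact le_antisymm this hBk

/-- Under the same hypotheses the two monotone quantities are themselves frozen from `k₀` on
(in the note: `rank Γ_k = rank D_k = 12` for every `k ≥ 1`). -/
theorem squeeze_ranks_const (T r d : ℕ → ℤ) (C B : ℤ) (k₀ : ℕ)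
    (hT : ∀ k, k₀ ≤ k → T k = C - r k - d k) (hr : Monotone r) (hd : Monotone d)
    (hB : ∀ k, k₀ ≤ k → B ≤ T k) (h0 : T k₀ = B) :
    ∀ k, k₀ ≤ k → r k = r k₀ ∧ d k = d k₀ := by
  intro k hk
  have hk' := squeeze_const T r d C B k₀ hT hr hd hB h0 k hk
  have hrk := hr hk
  have hdk := hd hk
  have hTk := hT k hk
  have hT0 := hT k₀ le_rfl
  rw [hk'] at hTk
  rw [h0] at hT0
  constructor <;> linarith

end Squeeze

end RankSqueeze

end Summit.Ventures.HSemireg
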